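import Literature.Combinatorics.Sahi2008.KahnIndependence
import Literature.Probability.Percolation.PositiveAssociation
import Literature.Probability.LatticeModels.SahiThirdOrderCorrelation
import HarnessLib

/-!
# Kahn (2022), Theorem 3 at `n = 3` and Corollary 4: a positively associated law that is NOT a monotone
# image of independent coins — and violates Sahi's `C₃`

CITATION HEADER.  Source: J. Kahn, *A note on positive association*, arXiv:2210.08653 (2022) [Kahn2022],
pp. 2–3, read from the materialised arXiv text.  Verbatim (p. 2): "Steif's original question was (2) *are
all PA measures FUI?* … **Theorem 3.** For a uniform permutation `σ` of `[n]`, the law, `µ_n`, of the set of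
fixed points of `σ` (that is, of `(X_1,…,X_n)`, where `X_i = 𝟙_{σ(i)=i}`) is PA.  **Corollary 4.** The answer
to (2) is negative.  *Proof.* This follows from Theorem 2 and the observation that `µ = µ₃` violates (3): `µ`
assigns weight `1/3` to `∅` and `1/6` to each of `{1}, {2}, {3}, {1,2,3}` (and `0` to pairs); so, with
`A_{i,j} = {σ fixes at least one of i, j}`, `A = A_{1,2}`, `B = A_{1,3}` and `C = A_{2,3}`, we have
`µ(A) = µ(B) = µ(C) = 1/2`, `µ(AB) = ⋯ = 1/3`, and `µ(ABC) = 1/6`, whence the hypotheses of (3) hold but the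
conclusion does not."  (Theorem 3 is Doyle–Fishburn–Shepp 1988 [DFS], "a quite painful case analysis".)
P. 3: "(4) [Sahi's `C₃`: `2µ(ABC) − [µ(AB)µ(C) + µ(AC)µ(B) + µ(BC)µ(A)] + µ(A)µ(B)µ(C) ≥ 0`], with Harris,
implies (3) (since under the hypotheses of (3), (4) becomes `µ(BC) ≤ µ(B)µ(C)`); so a positive answer to
Question 1 [are all PA measures UI?], even just for `µ₃`, would say Sahi's Conjecture … is false."

What is here (all PROVED; two small `def`s, no named fact):
* `Kahn2022.mu3` — Kahn's `µ₃` as a probability measure on `Set (Fin 3)` (fixed-point SETS; coordinates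
  `0, 1, 2`), `Kahn2022.mu3_real` (its values), `Kahn2022.pairEv i j = {S | i ∈ S ∨ j ∈ S}` (Kahn's `A_{i,j}`);
* **`Kahn2022.isPositivelyAssociated_mu3`** — Theorem 3 at `n = 3`: `µ₃` is positively associated
  (`Literature.Probability.Percolation.IsPositivelyAssociated`, all pairs of increasing events), by the finite
  check the printed "case analysis" reduces to at `n = 3` (an increasing family containing `∅` is everything, one
  not containing `univ` is null, otherwise `µ₃(𝒰) = (1 + #{i : {i} ∈ 𝒰})/6` and `64` cases);
* **`Kahn2022.mu3_violates_three`** — the displayed computation: `µ₃(𝒜) = 1/2 ≠ 0`,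
  `µ₃(𝒜ℬ𝒞) = µ₃(𝒜ℬ)µ₃(𝒞)`, `µ₃(𝒜𝒞ℬ) = µ₃(𝒜𝒞)µ₃(ℬ)`, but `µ₃(ℬ𝒞) = 1/3 ≠ 1/4 = µ₃(ℬ)µ₃(𝒞)`;
* **`Kahn2022.mu3_ne_map_prodBernoulli`** — Corollary 4: `µ₃` is NOT FUI, i.e. not the image of any
  non-degenerate product measure `prodBernoulli q` (finitely many independent coins) under any monotone
  `Φ : Set κ → Set (Fin 3)` — by Theorem 2 in its FUI form (`kahn2022_thm2_map`, `KahnIndependence.lean`);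
  packaged with positive association as **`Kahn2022.kahn2022_cor4`** ("the answer to (2) is negative");
* **`Kahn2022.sahiE3_mu3`** / **`Kahn2022.exists_isPositivelyAssociated_sahiE3_neg_kahn`** — the p. 3 remark
  made explicit: `E₃^{µ₃}(𝒜₁₂, 𝒜₁₃, 𝒜₂₃) = −1/24 < 0`, so positive association of a law does NOT imply Sahi's
  third-order inequality (`Literature.Probability.LatticeModels.sahiE3`): the Sahi hierarchy is strictly finer
  than positive association already at order three, with Kahn's printed witness.  (The cell's
  `Summit…Theorems.AssociationNoGo` gives another witness, `¼δ₀₀₀+⅙(δ₁₁₀+δ₁₀₁+δ₀₁₁)+¼δ₁₁₁`, `E₃ = −53/1728`, in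
  the same exchangeable family as the pattern law `⅓δ₀₀₀+⅙(δ₁₁₀+δ₁₀₁+δ₀₁₁)+⅙δ₁₁₁` of `(𝟙_𝒜,𝟙_ℬ,𝟙_𝒞)` under `µ₃`.)

Not here: Theorem 3 for general `n` (DFS), Question 1 (UI).

## References
* J. Kahn, *A note on positive association*, arXiv:2210.08653 (2022), Thm 3, Cor 4, Question 1, p. 3. [Kahn2022]
* P. Doyle, P. Fishburn, L. Shepp, *The match set of a random permutation has the FKG property*,
  Ann. Probab. 16 (1988) 1194–1214 (Kahn's [2]). [DFS — cited through Kahn2022]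
-/

noncomputable section

open Classical
open MeasureTheory Measure Set
open Literature.Probability.LatticeModels (prodBernoulli sahiE3)
open Literature.Probability.Percolation (IsPositivelyAssociated isPositivelyAssociated_of_real)

namespace Literature.Combinatorics.Sahi2008

namespace Kahn2022

/-! ### Kahn's `µ₃` on `Set (Fin 3)` -/

/-- **Kahn's `µ₃`**: the law of the fixed-point set of a uniform permutation of three letters — weight `1/3`
on `∅` (the two 3-cycles), `1/6` on each singleton (the three transpositions) and on `univ` (the identity),
`0` on pairs. [cite: Kahn2022, Theorem 3 and proof of Corollary 4 (p. 2)] -/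
def mu3 : Measure (Set (Fin 3)) :=
  ENNReal.ofReal (1/3) • dirac (∅ : Set (Fin 3)) + ENNReal.ofReal (1/6) • dirac ({0} : Set (Fin 3)) +
    ENNReal.ofReal (1/6) • dirac ({1} : Set (Fin 3)) + ENNReal.ofReal (1/6) • dirac ({2} : Set (Fin 3)) +
    ENNReal.ofReal (1/6) • dirac (univ : Set (Fin 3))

/-- The real weight `µ₃(𝒮)` of a family `𝒮` of subsets, as a sum over the five atoms.
[cite: Kahn2022, proof of Corollary 4 (p. 2)] -/
def w3 (𝒮 : Set (Set (Fin 3))) : ℝ :=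
  (if (∅ : Set (Fin 3)) ∈ 𝒮 then 1/3 else 0) + (if ({0} : Set (Fin 3)) ∈ 𝒮 then 1/6 else 0) +
    (if ({1} : Set (Fin 3)) ∈ 𝒮 then 1/6 else 0) + (if ({2} : Set (Fin 3)) ∈ 𝒮 then 1/6 else 0) +
    (if (univ : Set (Fin 3)) ∈ 𝒮 then 1/6 else 0)

/-- `w3 ≥ 0`. [cite: Kahn2022, proof of Corollary 4 (p. 2)] -/
theorem w3_nonneg (𝒮 : Set (Set (Fin 3))) : 0 ≤ w3 𝒮 := by
  unfold w3; positivity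

/-- `µ₃(𝒮) = w3 𝒮` in `ℝ≥0∞`. [cite: Kahn2022, proof of Corollary 4 (p. 2)] -/
theorem mu3_apply (𝒮 : Set (Set (Fin 3))) : mu3 𝒮 = ENNReal.ofReal (w3 𝒮) := by
  have hS : MeasurableSet 𝒮 := MeasurableSet.of_discrete
  simp only [mu3, w3, Measure.add_apply, Measure.smul_apply, smul_eq_mul, dirac_apply' _ hS, Set.indicator,
    Pi.one_apply, mul_ite, mul_one, mul_zero]
  have e : ∀ (q : Prop) [Decidable q] (c : ℝ), 0 ≤ c →
      (if q then ENNReal.ofReal c else 0) = ENNReal.ofReal (if q then c else 0) := by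
    intro q _ c _; split_ifs <;> simp
  rw [e _ (1/3) (by norm_num), e _ (1/6) (by norm_num), e _ (1/6) (by norm_num), e _ (1/6) (by norm_num),
    e _ (1/6) (by norm_num), ← ENNReal.ofReal_add, ← ENNReal.ofReal_add, ← ENNReal.ofReal_add, ← ENNReal.ofReal_add]
  all_goals positivity

/-- **The values of `µ₃`**: `µ₃(𝒮) = 1/3·[∅ ∈ 𝒮] + 1/6·([{0} ∈ 𝒮] + [{1} ∈ 𝒮] + [{2} ∈ 𝒮] + [univ ∈ 𝒮])`.
[cite: Kahn2022, proof of Corollary 4 (p. 2)] -/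
theorem mu3_real (𝒮 : Set (Set (Fin 3))) : mu3.real 𝒮 = w3 𝒮 := by
  rw [measureReal_def, mu3_apply, ENNReal.toReal_ofReal (w3_nonneg 𝒮)]

/-- `µ₃` is a probability measure (`1/3 + 4·1/6 = 1`). [cite: Kahn2022, Theorem 3 (p. 2)] -/
instance isProbabilityMeasure_mu3 : IsProbabilityMeasure mu3 := by
  refine ⟨?_⟩
  rw [mu3_apply]
  have : w3 univ = 1 := by simp only [w3, mem_univ, if_true]; norm_num
  rw [this, ENNReal.ofReal_one]

/-- Kahn's `A_{i,j} = {σ fixes at least one of i, j}`, as a family of fixed-point sets: `{S | i ∈ S ∨ j ∈ S}`.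
[cite: Kahn2022, proof of Corollary 4 (p. 2)] -/
def pairEv (i j : Fin 3) : Set (Set (Fin 3)) := {S | i ∈ S ∨ j ∈ S}

/-- `A_{i,j}` is increasing. [cite: Kahn2022, proof of Corollary 4 (p. 2)] -/
theorem isUpperSet_pairEv (i j : Fin 3) : IsUpperSet (pairEv i j) := by
  intro S T hST hS
  rcases hS with h | h
  · exact Or.inl (hST h)
  · exact Or.inr (hST h)

/-! ### Theorem 3 at `n = 3`: `µ₃` is positively associated -/

/-- **Kahn's Theorem 3 (Doyle–Fishburn–Shepp) at `n = 3`**: `µ₃` is positively associated — every two increasing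
families of subsets are positively correlated.  The finite check: an increasing `𝒰 ∋ ∅` is everything; an
increasing `𝒰 ∌ univ` is `µ₃`-null; otherwise `µ₃(𝒰) = (1 + #{i : {i} ∈ 𝒰})/6`, and
`(1+k)(1+l) ≤ 6(1 + #common singletons)` in all `64` cases. [cite: Kahn2022, Theorem 3 (p. 2)] -/
theorem isPositivelyAssociated_mu3 : IsPositivelyAssociated mu3 := by
  classical
  refine isPositivelyAssociated_of_real fun A B hA hB _ _ => ?_
  rw [mu3_real, mu3_real, mu3_real]
  have hbot : ∀ x : Set (Fin 3), (∅ : Set (Fin 3)) ≤ x := fun x => empty_subset x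
  have htop : ∀ x : Set (Fin 3), x ≤ (univ : Set (Fin 3)) := fun x => subset_univ x
  by_cases hA0 : (∅ : Set (Fin 3)) ∈ A
  · -- `A` is everything
    have hAall : ∀ x, x ∈ A := fun x => hA (hbot x) hA0
    have h1 : w3 A = 1 := by simp only [w3, hAall, if_true]; norm_num
    have h2 : w3 (A ∩ B) = w3 B := by simp only [w3, Set.mem_inter_iff, hAall, true_and]
    rw [h1, h2, one_mul]
  by_cases hB0 : (∅ : Set (Fin 3)) ∈ B
  · have hBall : ∀ x, x ∈ B := fun x => hB (hbot x) hB0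
    have h1 : w3 B = 1 := by simp only [w3, hBall, if_true]; norm_num
    have h2 : w3 (A ∩ B) = w3 A := by simp only [w3, Set.mem_inter_iff, hBall, and_true]
    rw [h1, h2, mul_one]
  by_cases hA1 : (univ : Set (Fin 3)) ∈ A
  swap
  · -- `A` is null
    have hAnone : ∀ x, x ∉ A := fun x hx => hA1 (hA (htop x) hx)
    have h1 : w3 A = 0 := by simp only [w3, hAnone, if_false]; norm_num
    rw [h1, zero_mul]; exact w3_nonneg _
  by_cases hB1 : (univ : Set (Fin 3)) ∈ B
  swap
  · have hBnone : ∀ x, x ∉ B := fun x hx => hB1 (hB (htop x) hx)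
    have h1 : w3 B = 0 := by simp only [w3, hBnone, if_false]; norm_num
    rw [h1, mul_zero]; exact w3_nonneg _
  -- main case: `∅ ∉ A, B`; `univ ∈ A, B`; split on the three singletons
  have hAB0 : (∅ : Set (Fin 3)) ∉ A ∩ B := fun h => hA0 h.1
  have hAB1 : (univ : Set (Fin 3)) ∈ A ∩ B := ⟨hA1, hB1⟩
  simp only [w3, hA0, hB0, hA1, hB1, hAB0, hAB1, if_true, if_false, Set.mem_inter_iff]
  by_cases a1 : ({0} : Set (Fin 3)) ∈ A <;> by_cases a2 : ({1} : Set (Fin 3)) ∈ A <;>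
    by_cases a3 : ({2} : Set (Fin 3)) ∈ A <;> by_cases b1 : ({0} : Set (Fin 3)) ∈ B <;>
    by_cases b2 : ({1} : Set (Fin 3)) ∈ B <;> by_cases b3 : ({2} : Set (Fin 3)) ∈ B <;>
    simp only [a1, a2, a3, b1, b2, b3, if_true, if_false, and_true, and_self, and_false] <;>
    norm_num

/-! ### Corollary 4: the hypotheses of (3) hold, its conclusion fails; `µ₃` is not FUI -/

/-- Distinctness of the three letters, for `simp`. [cite: Kahn2022, proof of Corollary 4 (p. 2)] -/
private theorem fin3_ne : (0 : Fin 3) ≠ 1 ∧ (0 : Fin 3) ≠ 2 ∧ (1 : Fin 3) ≠ 2 ∧ (1 : Fin 3) ≠ 0 ∧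
    (2 : Fin 3) ≠ 0 ∧ (2 : Fin 3) ≠ 1 := by decide

/-- The values in Kahn's display: `µ₃(𝒜₁₂) = µ₃(𝒜₁₃) = µ₃(𝒜₂₃) = 1/2`, all pairwise intersections `1/3`, the
triple intersection `1/6`. [cite: Kahn2022, proof of Corollary 4 (p. 2)] -/
theorem mu3_real_pairEv_values :
    mu3.real (pairEv 0 1) = 1/2 ∧ mu3.real (pairEv 0 2) = 1/2 ∧ mu3.real (pairEv 1 2) = 1/2 ∧
    mu3.real (pairEv 0 1 ∩ pairEv 0 2) = 1/3 ∧ mu3.real (pairEv 0 1 ∩ pairEv 1 2) = 1/3 ∧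
    mu3.real (pairEv 0 2 ∩ pairEv 1 2) = 1/3 ∧ mu3.real (pairEv 0 1 ∩ pairEv 0 2 ∩ pairEv 1 2) = 1/6 := by
  obtain ⟨h01, h02, h12, h10, h20, h21⟩ := fin3_ne
  simp only [mu3_real, w3, pairEv, Set.mem_inter_iff, Set.mem_setOf_eq, Set.mem_empty_iff_false,
    Set.mem_singleton_iff, Set.mem_univ, h01, h02, h12, h10, h20, h21, or_false, or_true,
    if_true, if_false, and_true, and_self, and_false]
  norm_num

/-- **`µ₃` violates (3)**: "the hypotheses of (3) hold but the conclusion does not" — `µ₃(𝒜) ≠ 0`,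
`𝒜ℬ ⊥ 𝒞`, `𝒜𝒞 ⊥ ℬ`, and `µ₃(ℬ𝒞) = 1/3 ≠ 1/4 = µ₃(ℬ)µ₃(𝒞)`, for `𝒜 = 𝒜₀₁`, `ℬ = 𝒜₀₂`, `𝒞 = 𝒜₁₂`.
[cite: Kahn2022, proof of Corollary 4 (p. 2)] -/
theorem mu3_violates_three :
    mu3.real (pairEv 0 1) ≠ 0 ∧
    mu3.real (pairEv 0 1 ∩ pairEv 0 2 ∩ pairEv 1 2) = mu3.real (pairEv 0 1 ∩ pairEv 0 2) * mu3.real (pairEv 1 2) ∧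
    mu3.real (pairEv 0 1 ∩ pairEv 1 2 ∩ pairEv 0 2) = mu3.real (pairEv 0 1 ∩ pairEv 1 2) * mu3.real (pairEv 0 2) ∧
    mu3.real (pairEv 0 2 ∩ pairEv 1 2) ≠ mu3.real (pairEv 0 2) * mu3.real (pairEv 1 2) := by
  obtain ⟨hA, hB, hC, hAB, hAC, hBC, hABC⟩ := mu3_real_pairEv_values
  have hACB : mu3.real (pairEv 0 1 ∩ pairEv 1 2 ∩ pairEv 0 2) = 1/6 := by
    rw [show pairEv 0 1 ∩ pairEv 1 2 ∩ pairEv 0 2 = pairEv 0 1 ∩ pairEv 0 2 ∩ pairEv 1 2 from by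
      ext S; simp only [Set.mem_inter_iff]; tauto]
    exact hABC
  refine ⟨by rw [hA]; norm_num, by rw [hABC, hAB, hC]; norm_num, by rw [hACB, hAC, hB]; norm_num, ?_⟩
  rw [hBC, hB, hC]; norm_num

/-- **Kahn's Corollary 4, the mechanism**: `µ₃` is NOT FUI — it is not the image of any non-degenerate product
measure on finitely many coins under any monotone map (Theorem 2 in its FUI form, `kahn2022_thm2_map`, would force
`ℬ ⊥ 𝒞`). [cite: Kahn2022, Corollary 4 (p. 2)] -/
theorem mu3_ne_map_prodBernoulli {κ : Type*} [Fintype κ] {q : κ → unitInterval}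
    (hq : ∀ k, 0 < q k ∧ q k < 1) {Φ : Set κ → Set (Fin 3)} (hΦ : Monotone Φ) :
    (prodBernoulli q).map Φ ≠ mu3 := by
  intro h
  obtain ⟨hA0, hABC, hACB, hBC⟩ := mu3_violates_three
  have key := kahn2022_thm2_map hq hΦ (isUpperSet_pairEv 0 1) (isUpperSet_pairEv 0 2) (isUpperSet_pairEv 1 2)
  rw [h] at key
  exact hBC (key hA0 hABC hACB)

/-- **Kahn's Corollary 4: "the answer to (2) [are all PA measures FUI?] is negative"** — `µ₃` is a positively
associated probability measure on `2^{[3]}` that is not a monotone image of finitely many independent coins.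
[cite: Kahn2022, Corollary 4 (p. 2)] -/
theorem kahn2022_cor4 :
    ∃ μ : Measure (Set (Fin 3)), IsProbabilityMeasure μ ∧ IsPositivelyAssociated μ ∧
      ∀ (κ : Type) [Fintype κ] (q : κ → unitInterval), (∀ k, 0 < q k ∧ q k < 1) →
        ∀ Φ : Set κ → Set (Fin 3), Monotone Φ → (prodBernoulli q).map Φ ≠ μ :=
  ⟨mu3, isProbabilityMeasure_mu3, isPositivelyAssociated_mu3,
    fun _ _ _ hq _ hΦ => mu3_ne_map_prodBernoulli hq hΦ⟩

/-! ### The p. 3 remark: positive association does not give Sahi's `C₃` -/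

/-- **`E₃^{µ₃}(𝒜₀₁, 𝒜₀₂, 𝒜₁₂) = −1/24`**: `2·(1/6) − 3·(1/2)(1/3) + (1/2)³`.  [cite: Kahn2022, p. 3 ("(4), with
Harris, implies (3)") and Corollary 4] -/
theorem sahiE3_mu3 : sahiE3 mu3 (pairEv 0 1) (pairEv 0 2) (pairEv 1 2) = -1/24 := by
  obtain ⟨hA, hB, hC, hAB, hAC, hBC, hABC⟩ := mu3_real_pairEv_values
  rw [Literature.Probability.LatticeModels.sahiE3_def, hABC, hA, hB, hC, hBC, hAC, hAB]
  norm_num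

/-- **Positive association does NOT imply Sahi's third-order inequality** — with Kahn's printed witness: `µ₃` is
a positively associated probability measure and `𝒜₀₁, 𝒜₀₂, 𝒜₁₂` are increasing events with
`E₃(𝒜₀₁, 𝒜₀₂, 𝒜₁₂) = −1/24 < 0`.  (So the Sahi hierarchy `C₃ ⇒ C₂` is strict for general probability laws; for FKG
/ product measures `C₃` is Sahi's conjecture = Kahn's Conjecture 5, open.) [cite: Kahn2022, p. 3 and Corollary 4] -/
theorem exists_isPositivelyAssociated_sahiE3_neg_kahn :
    ∃ μ : Measure (Set (Fin 3)), IsProbabilityMeasure μ ∧ IsPositivelyAssociated μ ∧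
      ∃ 𝒜 ℬ 𝒞 : Set (Set (Fin 3)), IsUpperSet 𝒜 ∧ IsUpperSet ℬ ∧ IsUpperSet 𝒞 ∧ sahiE3 μ 𝒜 ℬ 𝒞 < 0 :=
  ⟨mu3, isProbabilityMeasure_mu3, isPositivelyAssociated_mu3, pairEv 0 1, pairEv 0 2, pairEv 1 2,
    isUpperSet_pairEv 0 1, isUpperSet_pairEv 0 2, isUpperSet_pairEv 1 2, by rw [sahiE3_mu3]; norm_num⟩

end Kahn2022

end Literature.Combinatorics.Sahi2008

end
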